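import Mathlib.MeasureTheory.Measure.LevyProkhorovMetric
import Mathlib.Analysis.SpecialFunctions.Complex.Circle
import Mathlib.Analysis.Complex.Isometry
import Literature.Probability.RandomPlanarGeometry.Curve
import Literature.Probability.RandomPlanarGeometry.CurveSpace
import Literature.Probability.RandomPlanarGeometry.CurveTortuosity
import Literature.Probability.RandomPlanarGeometry.LoopEnsembleSpace
import HarnessLib

/-!
# Maps of loop space: time reversal, push-forwards, reflections, and the Lévy–Prokhorov edistance

General glue on the Aizenman–Burchard / Camia–Newman spaces of the prelude (`Curve`, `CurveClass`,
`LoopSpace`), extracted from the formalisation of Duminil-Copin–Kozlowski–Krachun–Manolescu–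
Oulamara, arXiv:2012.11672v2 (2026), Remark 1.8 (`Literature.Probability.Percolation.
LoopRotationInvarianceAssembly`), where lattice reflections act on collections of *oriented*
interface loops by reflect-and-reverse:

* `Curve.reverse` API beyond the prelude's (`CurveTortuosity`): `reverse_reparam`, `reverse_map`,
  `dist_reverse_reverse` (time reversal is an isometry of the reparametrisation pseudo-metric,
  by conjugating reparametrisations with `t ↦ 1 - t`, `OrderIso.conjSymm`);
  `CurveClass.reverse` (time reversal of curve classes; an isometric involution commuting with
  push-forwards), `CurveClass.isometry_map`, `CurveClass.map_map`.
* `LoopSpace.induced Φ` (push a closed set of curve classes along a map `Φ` of curve space and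
  close up; `LoopSpace.map f = induced (CurveClass.map f)`), functoriality, and
  `LoopSpace.isometry_induced` for isometric `Φ` (Hausdorff edistance).
* `levyProkhorovEDist_map_le_of_lipschitz`: the Lévy–Prokhorov edistance does not increase under
  push-forward by a `1`-Lipschitz map; `levyProkhorovEDist_map_eq_of_isometry`: it is invariant
  under push-forward by an isometry with a measurable `1`-Lipschitz inverse.
* `lineReflection β : ℂ ≃ₗᵢ[ℝ] ℂ`, `z ↦ e^{2iβ} z̄` (DKKMO's `S_β`, the reflection in `e^{iβ}ℝ`),
  `LoopSpace.reflectReverse S` (push forward along the linear isometry `S` and reverse time),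
  `LoopSpace.rotate α`; `reflectReverse_lineReflection_zero`: `S_β`-then-reverse after
  `S_0`-then-reverse is the rotation by `2β` (Remark 1.8: two reflections compose to a rotation).

## References

* M. Aizenman, A. Burchard, Duke Math. J. 99 (1999), §2.1 (curves modulo reparametrisation).
* H. Duminil-Copin, K. K. Kozlowski, D. Krachun, I. Manolescu, M. Oulamara, arXiv:2012.11672v2
  (2026), Remark 1.8, §4.1 (the reflections `S_{α/2}`).
* R. M. Dudley, *Real Analysis and Probability* (2002), §11.3 (Prokhorov metric).
-/

noncomputable section

open MeasureTheory Set
open scoped ENNReal unitInterval Real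

namespace Literature.Probability.RandomPlanarGeometry


/-! ### Time reversal of curves and curve classes (`Curve.reverse` is the prelude's, `CurveTortuosity`) -/

/-- Conjugating an increasing reparametrisation of `[0, 1]` by the time reversal `σ : t ↦ 1 - t`
gives an increasing reparametrisation. [folklore] -/
def _root_.OrderIso.conjSymm (φ : I ≃o I) : I ≃o I where
  toFun t := σ (φ (σ t))
  invFun t := σ (φ.symm (σ t))
  left_inv t := by simp
  right_inv t := by simp
  map_rel_iff' {a b} := by
    change σ (φ (σ a)) ≤ σ (φ (σ b)) ↔ a ≤ b
    rw [unitInterval.symm_le_symm, φ.le_iff_le, unitInterval.symm_le_symm]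

/-- Unfolding `OrderIso.conjSymm`. [folklore] -/
@[simp] lemma _root_.OrderIso.conjSymm_apply (φ : I ≃o I) (t : I) :
    φ.conjSymm t = σ (φ (σ t)) := rfl

namespace Curve

variable {E F : Type*}

section Topological

variable [TopologicalSpace E] [TopologicalSpace F]

/-- Time reversal conjugates reparametrisations. [folklore] -/
lemma reverse_reparam (γ : Curve E) (φ : I ≃o I) :
    (γ.reparam φ).reverse = γ.reverse.reparam φ.conjSymm := by
  ext t; simp

/-- Time reversal commutes with push-forward along a continuous map. [folklore] -/
lemma reverse_map (f : C(E, F)) (γ : Curve E) : (γ.map f).reverse = γ.reverse.map f := rfl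

/-- The reversed curve starts at the old endpoint. [folklore] -/
@[simp] lemma source_reverse (γ : Curve E) : γ.reverse.source = γ.target := by
  simp [source_def, target_def]

/-- The reversed curve ends at the old starting point. [folklore] -/
@[simp] lemma target_reverse (γ : Curve E) : γ.reverse.target = γ.source := by
  simp [source_def, target_def]

end Topological

section Metric

variable [PseudoMetricSpace E]

/-- Precomposition with the time reversal preserves the sup distance. [folklore] -/
lemma dist_toContinuousMap_reverse (γ₁ γ₂ : Curve E) :
    dist γ₁.reverse.toContinuousMap γ₂.reverse.toContinuousMap =
      dist γ₁.toContinuousMap γ₂.toContinuousMap := by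
  refine le_antisymm ?_ ?_
  · refine (ContinuousMap.dist_le dist_nonneg).2 fun t ↦ ?_
    exact ContinuousMap.dist_apply_le_dist (f := γ₁.toContinuousMap) (g := γ₂.toContinuousMap)
      (σ t)
  · refine (ContinuousMap.dist_le dist_nonneg).2 fun t ↦ ?_
    have := ContinuousMap.dist_apply_le_dist (f := γ₁.reverse.toContinuousMap)
      (g := γ₂.reverse.toContinuousMap) (x := σ t)
    simpa using this

/-- Time reversal does not increase the reparametrisation distance. [folklore] -/
lemma reparamDist_reverse_le (γ₁ γ₂ : Curve E) :
    reparamDist γ₁.reverse γ₂.reverse ≤ reparamDist γ₁ γ₂ := by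
  refine le_ciInf fun φ ↦ ?_
  have h := reparamDist_le γ₁.reverse γ₂.reverse φ.conjSymm
  rw [← reverse_reparam, dist_toContinuousMap_reverse] at h
  exact h

/-- Time reversal is an isometry for the reparametrisation distance
(Aizenman–Burchard 1999, §2.1). [folklore] -/
@[simp] lemma dist_reverse_reverse (γ₁ γ₂ : Curve E) :
    dist γ₁.reverse γ₂.reverse = dist γ₁ γ₂ := by
  refine le_antisymm (reparamDist_reverse_le γ₁ γ₂) ?_
  have h := reparamDist_reverse_le γ₁.reverse γ₂.reverse
  rwa [reverse_reverse, reverse_reverse] at h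

variable [PseudoMetricSpace F]

/-- Push-forward along an isometry preserves the sup distance of parametrised curves. [folklore] -/
lemma dist_toContinuousMap_map_of_isometry {f : C(E, F)} (hf : Isometry f) (γ₁ γ₂ : Curve E) :
    dist (γ₁.map f).toContinuousMap (γ₂.map f).toContinuousMap =
      dist γ₁.toContinuousMap γ₂.toContinuousMap := by
  refine le_antisymm ?_ ?_
  · refine (ContinuousMap.dist_le dist_nonneg).2 fun t ↦ ?_
    change dist (f (γ₁ t)) (f (γ₂ t)) ≤ _
    rw [hf.dist_eq]
    exact ContinuousMap.dist_apply_le_dist (f := γ₁.toContinuousMap) (g := γ₂.toContinuousMap) t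
  · refine (ContinuousMap.dist_le dist_nonneg).2 fun t ↦ ?_
    have := ContinuousMap.dist_apply_le_dist (f := (γ₁.map f).toContinuousMap)
      (g := (γ₂.map f).toContinuousMap) (x := t)
    change dist (f (γ₁ t)) (f (γ₂ t)) ≤ _ at this
    rwa [hf.dist_eq] at this

/-- Push-forward along an isometry preserves the reparametrisation distance. [folklore] -/
lemma dist_map_map_of_isometry {f : C(E, F)} (hf : Isometry f) (γ₁ γ₂ : Curve E) :
    dist (γ₁.map f) (γ₂.map f) = dist γ₁ γ₂ := by
  simp only [dist_def, reparamDist]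
  congr 1
  ext φ
  rw [← map_reparam, dist_toContinuousMap_map_of_isometry hf]

end Metric

end Curve

namespace CurveClass

variable {E F G : Type*} [MetricSpace E] [MetricSpace F] [MetricSpace G]

/-- Time reversal of a curve class (well defined because reversal is an isometry of the
reparametrisation pseudo-metric). Interface loops are oriented (primal cluster on the left), and
a reflection of the lattice reverses this orientation; `reverse` restores it.
(Aizenman–Burchard 1999, §2.1.) [folklore] -/
def reverse : CurveClass E → CurveClass E :=
  SeparationQuotient.lift (mk ∘ Curve.reverse) fun a b h ↦ by
    simp only [Function.comp_apply, mk_eq_mk_iff_dist_eq_zero, Curve.dist_reverse_reverse]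
    exact Metric.inseparable_iff.1 h

/-- `reverse` on the class of a curve. [folklore] -/
@[simp] lemma reverse_mk (γ : Curve E) : reverse (mk γ) = mk γ.reverse := rfl

/-- Time reversal of classes is an involution. [folklore] -/
@[simp] lemma reverse_reverse (c : CurveClass E) : c.reverse.reverse = c := by
  obtain ⟨γ, rfl⟩ := surjective_mk c
  simp

/-- Time reversal is an isometry of curve space. [folklore] -/
lemma isometry_reverse : Isometry (reverse : CurveClass E → CurveClass E) := by
  refine Isometry.of_dist_eq fun c₁ c₂ ↦ ?_
  obtain ⟨γ₁, rfl⟩ := surjective_mk c₁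
  obtain ⟨γ₂, rfl⟩ := surjective_mk c₂
  simp

/-- Time reversal commutes with push-forward. [folklore] -/
lemma reverse_map (f : C(E, F)) (c : CurveClass E) : (c.map f).reverse = c.reverse.map f := by
  obtain ⟨γ, rfl⟩ := surjective_mk c
  rfl

/-- Time reversal does not change the trace. [folklore] -/
@[simp] lemma range_reverse (c : CurveClass E) : c.reverse.range = c.range := by
  obtain ⟨γ, rfl⟩ := surjective_mk c
  simp

/-- Push-forward along an isometry is an isometry of curve spaces. [folklore] -/
lemma isometry_map {f : C(E, F)} (hf : Isometry f) : Isometry (map f : CurveClass E → _) := by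
  refine Isometry.of_dist_eq fun c₁ c₂ ↦ ?_
  obtain ⟨γ₁, rfl⟩ := surjective_mk c₁
  obtain ⟨γ₂, rfl⟩ := surjective_mk c₂
  simp [Curve.dist_map_map_of_isometry hf]

/-- Functoriality of push-forward. [folklore] -/
lemma map_map (f : C(E, F)) (g : C(F, G)) (c : CurveClass E) :
    (c.map f).map g = c.map (g.comp f) := by
  obtain ⟨γ, rfl⟩ := surjective_mk c
  rfl

/-- Push-forward along the identity. [folklore] -/
@[simp] lemma map_id (c : CurveClass E) : c.map (ContinuousMap.id E) = c := by
  obtain ⟨γ, rfl⟩ := surjective_mk c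
  rfl

end CurveClass

/-! ### Loop collections pushed along maps of curve space -/

namespace LoopSpace

variable {E F G : Type*} [MetricSpace E] [MetricSpace F] [MetricSpace G]

/-- Push a loop collection along a map `Φ` of curve spaces: the closure of the image (for
`Φ = CurveClass.map f` this is `LoopSpace.map f`). [folklore] -/
def induced (Φ : CurveClass E → CurveClass F) (L : LoopSpace E) : LoopSpace F :=
  ⟨closure (Φ '' (L : Set (CurveClass E))), isClosed_closure⟩

/-- The carrier of `induced Φ L`. [folklore] -/
@[simp] lemma coe_induced (Φ : CurveClass E → CurveClass F) (L : LoopSpace E) :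
    (induced Φ L : Set (CurveClass F)) = closure (Φ '' (L : Set (CurveClass E))) := rfl

/-- `LoopSpace.map` is `induced` of `CurveClass.map`. [folklore] -/
lemma map_eq_induced (f : C(E, F)) (L : LoopSpace E) : map f L = induced (CurveClass.map f) L :=
  rfl

/-- Functoriality of `induced` (for a continuous second map). [folklore] -/
lemma induced_induced {Φ : CurveClass E → CurveClass F} {Ψ : CurveClass F → CurveClass G}
    (hΨ : Continuous Ψ) (L : LoopSpace E) :
    induced Ψ (induced Φ L) = induced (Ψ ∘ Φ) L := by
  refine TopologicalSpace.Closeds.ext ?_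
  simp only [coe_induced, Set.image_comp]
  exact closure_image_closure hΨ

/-- `induced id` is the identity. [folklore] -/
@[simp] lemma induced_id (L : LoopSpace E) : induced id L = L := by
  refine TopologicalSpace.Closeds.ext ?_
  simp [L.isClosed.closure_eq]

/-- `induced` of an isometry preserves the Hausdorff edistance. [folklore] -/
lemma edist_induced_induced {Φ : CurveClass E → CurveClass F} (hΦ : Isometry Φ)
    (L L' : LoopSpace E) : edist (induced Φ L) (induced Φ L') = edist L L' := by
  rw [TopologicalSpace.Closeds.edist_eq, TopologicalSpace.Closeds.edist_eq, coe_induced,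
    coe_induced, Metric.hausdorffEDist_closure, Metric.hausdorffEDist_image hΦ]

/-- `induced` of an isometry is an isometry of loop spaces. [folklore] -/
lemma isometry_induced {Φ : CurveClass E → CurveClass F} (hΦ : Isometry Φ) :
    Isometry (induced Φ : LoopSpace E → LoopSpace F) :=
  fun L L' ↦ edist_induced_induced hΦ L L'

/-- `induced` of an isometry is Borel measurable. [folklore] -/
lemma measurable_induced {Φ : CurveClass E → CurveClass F} (hΦ : Isometry Φ) :
    Measurable (induced Φ : LoopSpace E → LoopSpace F) :=
  (isometry_induced hΦ).continuous.measurable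

end LoopSpace

/-! ### The Lévy–Prokhorov edistance under `1`-Lipschitz push-forwards -/

section LP

variable {X Y : Type*} [PseudoEMetricSpace X] [PseudoEMetricSpace Y]

/-- A `1`-Lipschitz map thickens preimages into preimages of thickenings. [folklore] -/
lemma thickening_preimage_subset {f : X → Y} (hf : LipschitzWith 1 f) (ε : ℝ) (B : Set Y) :
    Metric.thickening ε (f ⁻¹' B) ⊆ f ⁻¹' Metric.thickening ε B := by
  intro x hx
  rw [Metric.mem_thickening_iff_infEDist_lt] at hx
  rw [mem_preimage, Metric.mem_thickening_iff_infEDist_lt]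
  refine lt_of_le_of_lt (le_iInf₂ fun z hz ↦ ?_) hx
  calc Metric.infEDist (f x) B ≤ edist (f x) (f z) := Metric.infEDist_le_edist_of_mem hz
    _ ≤ edist x z := by simpa using hf x z

variable [MeasurableSpace X] [MeasurableSpace Y] [OpensMeasurableSpace Y]

/-- Pushing two measures forward along a `1`-Lipschitz measurable map does not increase their
Lévy–Prokhorov edistance. (Dudley 2002, §11.3.) [folklore] -/
theorem levyProkhorovEDist_map_le_of_lipschitz {f : X → Y} (hf : LipschitzWith 1 f)
    (hfm : Measurable f) (μ ν : Measure X) :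
    levyProkhorovEDist (μ.map f) (ν.map f) ≤ levyProkhorovEDist μ ν := by
  refine levyProkhorovEDist_le_of_forall _ _ _ fun ε B hlt _ hB ↦ ?_
  have hB' : MeasurableSet (f ⁻¹' B) := hfm hB
  have hT : MeasurableSet (Metric.thickening ε.toReal B) :=
    Metric.isOpen_thickening.measurableSet
  rw [Measure.map_apply hfm hB, Measure.map_apply hfm hB, Measure.map_apply hfm hT,
    Measure.map_apply hfm hT]
  constructor
  · calc μ (f ⁻¹' B) ≤ ν (Metric.thickening ε.toReal (f ⁻¹' B)) + ε :=
        left_measure_le_of_levyProkhorovEDist_lt hlt hB'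
      _ ≤ ν (f ⁻¹' Metric.thickening ε.toReal B) + ε := by
        gcongr; exact thickening_preimage_subset hf _ _
  · calc ν (f ⁻¹' B) ≤ μ (Metric.thickening ε.toReal (f ⁻¹' B)) + ε :=
        right_measure_le_of_levyProkhorovEDist_lt hlt hB'
      _ ≤ μ (f ⁻¹' Metric.thickening ε.toReal B) + ε := by
        gcongr; exact thickening_preimage_subset hf _ _

variable [OpensMeasurableSpace X]

/-- The Lévy–Prokhorov edistance is invariant under push-forward along a measurable map with a
measurable left inverse, both `1`-Lipschitz (e.g. an isometric bijection). [folklore] -/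
theorem levyProkhorovEDist_map_eq_of_isometry {f : X → Y} {g : Y → X} (hf : LipschitzWith 1 f)
    (hg : LipschitzWith 1 g) (hfm : Measurable f) (hgm : Measurable g)
    (hgf : Function.LeftInverse g f) (μ ν : Measure X) :
    levyProkhorovEDist (μ.map f) (ν.map f) = levyProkhorovEDist μ ν := by
  refine le_antisymm (levyProkhorovEDist_map_le_of_lipschitz hf hfm μ ν) ?_
  have h := levyProkhorovEDist_map_le_of_lipschitz hg hgm (μ.map f) (ν.map f)
  rwa [Measure.map_map hgm hfm, Measure.map_map hgm hfm, hgf.comp_eq_id, Measure.map_id,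
    Measure.map_id] at h

end LP

/-! ### Reflections of the plane and their action on oriented loop collections -/

/-- The reflection of `ℂ` in the line `e^{iβ}ℝ`: `z ↦ e^{2iβ} z̄` (DKKMO's `S_β`), a linear
isometry. (DKKMO, arXiv:2012.11672v2, §4.1: "`S_{α/2}` the orthogonal reflection with respect to
`e^{iα/2}`".) [cite: arXiv201211672v2, §4.1] -/
def lineReflection (β : ℝ) : ℂ ≃ₗᵢ[ℝ] ℂ :=
  Complex.conjLIE.trans (rotation (Circle.exp (2 * β)))

/-- `lineReflection β z = e^{2iβ} z̄`. (DKKMO, arXiv:2012.11672v2, §4.1.) [cite: arXiv201211672v2, §4.1] -/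
lemma lineReflection_apply (β : ℝ) (z : ℂ) :
    lineReflection β z = Circle.exp (2 * β) * (starRingEnd ℂ) z := rfl

/-- A reflection is an involution. [folklore] -/
@[simp] lemma lineReflection_lineReflection (β : ℝ) (z : ℂ) :
    lineReflection β (lineReflection β z) = z := by
  rw [lineReflection_apply, lineReflection_apply, RingHom.map_mul, Complex.conj_conj, ← mul_assoc,
    ← Circle.coe_inv_eq_conj, ← Circle.coe_mul, mul_inv_cancel, Circle.coe_one, one_mul]

/-- Two reflections compose to a rotation: `S_β ∘ S_0` is the rotation by `2β` (DKKMO, Remark 1.8: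
"the composition of the reflections with respect to the horizontal axis and to `e^{iα/2}ℝ`
produces the rotation by an angle `α`"). [cite: arXiv201211672v2, Remark 1.8] -/
lemma lineReflection_lineReflection_zero (β : ℝ) (z : ℂ) :
    lineReflection β (lineReflection 0 z) = rotation (Circle.exp (2 * β)) z := by
  rw [lineReflection_apply, lineReflection_apply, rotation_apply, mul_zero, Circle.exp_zero,
    Circle.coe_one, one_mul, Complex.conj_conj]

/-- The continuous map underlying a linear isometry equivalence of `ℂ` (bookkeeping). [folklore] -/
abbrev toCM (S : ℂ ≃ₗᵢ[ℝ] ℂ) : C(ℂ, ℂ) := ⟨S, S.continuous⟩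

namespace LoopSpace

/-- The action on oriented loop collections of a linear isometry `S` of the plane that reverses
orientation: push every loop forward along `S` and reverse its time (so that interface loops keep
the primal cluster on their left). [folklore] -/
def reflectReverse (S : ℂ ≃ₗᵢ[ℝ] ℂ) : LoopSpace ℂ → LoopSpace ℂ :=
  induced (CurveClass.reverse ∘ CurveClass.map (toCM S))

/-- Reflect-and-reverse is an isometry of curve space. [folklore] -/
lemma isometry_reverse_comp_map (S : ℂ ≃ₗᵢ[ℝ] ℂ) :
    Isometry (CurveClass.reverse ∘ CurveClass.map (toCM S) : CurveClass ℂ → CurveClass ℂ) :=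
  CurveClass.isometry_reverse.comp (CurveClass.isometry_map (f := toCM S) S.isometry)

/-- `reflectReverse S` is an isometry of `LoopSpace ℂ`. [folklore] -/
lemma isometry_reflectReverse (S : ℂ ≃ₗᵢ[ℝ] ℂ) : Isometry (reflectReverse S) :=
  isometry_induced (isometry_reverse_comp_map S)

/-- `reflectReverse S` is Borel measurable. [folklore] -/
lemma measurable_reflectReverse (S : ℂ ≃ₗᵢ[ℝ] ℂ) : Measurable (reflectReverse S) :=
  (isometry_reflectReverse S).continuous.measurable

/-- Two reflect-and-reverse operations compose to the push-forward along the composite isometry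
(the two time reversals cancel). [folklore] -/
lemma reflectReverse_reflectReverse (S T : ℂ ≃ₗᵢ[ℝ] ℂ) (L : LoopSpace ℂ) :
    reflectReverse S (reflectReverse T L) = induced (CurveClass.map (toCM (T.trans S))) L := by
  rw [reflectReverse, reflectReverse, induced_induced (isometry_reverse_comp_map S).continuous]
  congr 1
  funext c
  simp only [Function.comp_apply, ← CurveClass.reverse_map, CurveClass.reverse_reverse,
    CurveClass.map_map]
  rfl

/-- For an involutive `S`, `reflectReverse S` is an involution. [folklore] -/
lemma reflectReverse_reflectReverse_self {S : ℂ ≃ₗᵢ[ℝ] ℂ} (hS : ∀ z, S (S z) = z)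
    (L : LoopSpace ℂ) : reflectReverse S (reflectReverse S L) = L := by
  rw [reflectReverse_reflectReverse]
  have : CurveClass.map (toCM (S.trans S)) = id := by
    funext c
    have hid : toCM (S.trans S) = ContinuousMap.id ℂ := by ext z; exact hS z
    rw [hid, CurveClass.map_id]; rfl
  rw [this, induced_id]

/-- Push-forward along the rotation by `α`, as an operation on loop collections. [folklore] -/
abbrev rotate (α : ℝ) : LoopSpace ℂ → LoopSpace ℂ :=
  induced (CurveClass.map (toCM (rotation (Circle.exp α))))

/-- Rotations of loop collections are isometries. [folklore] -/
lemma isometry_rotate (α : ℝ) : Isometry (rotate α) :=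
  isometry_induced (CurveClass.isometry_map (rotation (Circle.exp α)).isometry)

/-- Rotations of loop collections compose. [folklore] -/
lemma rotate_rotate (α β : ℝ) (L : LoopSpace ℂ) : rotate α (rotate β L) = rotate (α + β) L := by
  rw [rotate, rotate, induced_induced (CurveClass.isometry_map (f := toCM _)
    (rotation (Circle.exp α)).isometry).continuous]
  congr 1
  funext c
  simp only [Function.comp_apply, CurveClass.map_map]
  congr 1
  ext z
  simp [rotation_apply, Circle.exp_add]

/-- The rotation by `0` acts trivially. [folklore] -/
@[simp] lemma rotate_zero (L : LoopSpace ℂ) : rotate 0 L = L := by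
  have : CurveClass.map (toCM (rotation (Circle.exp 0))) = id := by
    funext c
    have hid : toCM (rotation (Circle.exp 0)) = ContinuousMap.id ℂ := by
      ext z; simp
    rw [hid, CurveClass.map_id]; rfl
  rw [rotate, this, induced_id]

/-- `S_β`-then-reverse after `S_0`-then-reverse is the rotation by `2β` (DKKMO, Remark 1.8). [cite: arXiv201211672v2, Remark 1.8] -/
lemma reflectReverse_lineReflection_zero (β : ℝ) (L : LoopSpace ℂ) :
    reflectReverse (lineReflection β) (reflectReverse (lineReflection 0) L) = rotate (2 * β) L := by
  rw [reflectReverse_reflectReverse]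
  congr 2
  ext z
  exact lineReflection_lineReflection_zero β z

end LoopSpace

end Literature.Probability.RandomPlanarGeometry

end
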